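import Literature.MathematicalPhysics.QuantumFieldTheory.Balaban1983to89.B9SectBGWordDiffY
import Literature.MathematicalPhysics.QuantumFieldTheory.Balaban1983to89.B9Eq3104CommutatorGradFormCurl
import Literature.MathematicalPhysics.QuantumFieldTheory.Balaban1983to89.B9Eq37Insertion

/-!
# Balaban [B9], (3.4), (3.7) p. 391 — NODE 00's covariant curl `D_U` (`curlY`), plaquette variable `U(∂p)` (`holY`) and its `Re ∕ Im` (`reHolY ∕ imHolY`)
# ARE pv27 ∕ r06's `curl`, `plaqU`, `reC ∕ imC` IN BOND COORDINATES: `curlY_eq_curl`, `holY_eq_plaqU`, `reHolY_eq_reC`, `imHolY_eq_imC`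
# (pub-ymgap N06 G-side plan, Route L, the first bricks of L-3 = the identification of NODE 00's Hessian `hessY` with `lapDDLetter + dPrimeLetter`)

T. Bałaban, *Propagators for lattice gauge theories in a background field*, Commun. Math. Phys. **99** (1985) 389–434
[`Balaban1985BackgroundPropagators`, "B9"].

statement-level skeleton of published theorems with citation tags; proofs where landed; nothing here is a claim about the
Yang–Mills mass gap

THE PRINTED LOCI.  (3.4) p. 391 (the covariant exterior derivative `D_U A` on plaquettes); (3.7) p. 391 (`U(∂p)`, `Re U(∂p) = ½(U(∂p) + U(−∂p))`,
`Im U(∂p) = (1/2i)(U(∂p) − U(−∂p))`).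

WHY THIS FILE (seat dag-n06-c gen 13; G-SIDE-PLAN v2, Route L, file L-3).  r06's concrete `Δ(U)` word for the bond sector is `lapDDLetter T η⁻¹ V + dPrimeLetter
T V η` (pv27's `B9Eq310Hermitian.deltaOp = divPη(curlη ·) + deltaPrimeOp`, built from `B9Eq39Adjoint.curl`, `plaqU`, `B9Eq37Insertion.reC ∕ imC`); NODE 00's
is `hessY U = coCurlY U ∘ jordanY U ∘ curlY U + curv2Y U` (built from `curlY`, `holY`, `reHolY`, `imHolY`).  The identification (L-3) is assembled letter by
letter; THIS FILE gives the four innermost letters, exactly, for every `U`, `A`, `p`, `𝔸`: in the bond coordinates of `Node00/OpsYBondCoords`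
(`F κ z := bondFunCoordsY A (κ, z)`), `curlY U A p = c_f • curl (shiftY) (UboxY U) F p.μ p.ν (chart p.src)`; `holY U p = plaqU (shiftY) (UboxY U) p.μ p.ν
(chart p.src)` (same start point `x`, same orientation `μ` then `ν`); `reHolY = reC ∘ holY`, `imHolY = imC ∘ holY`.  The REMAINING bricks of L-3 (not
here): `coCurlY` versus pv27's `divP` (the (3.9) adjoint, def-Y's `coCurlY_apply_eq` versus `divP`'s «first form»), `jordanY` versus `jordanF` (the
`Re` versus `Re − 1` split: `η⁻²D*D + D*(½{D·, z}) = η⁻²D*(½{D·, Re})`, `z = η⁻²(Re − 1)`), and `curv2Y` versus `divL (commG₁ … commG₄)` (the (3.2) letters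
`A′_m`: def-Y `edgeY ∕ sgnY ∕ edgeParY` = pv27 `lettersA` — same order, same signs, same transporters, checked by reading; the commutator slot
`(i/2)[y, S_k] = ½·i[Σ_{≻} − Σ_{≺}, y]`).

HONEST SCOPE.  Exact identities between DEFINED objects; no estimate; nothing of [B9] asserted; count-neutral; N06 NOT discharged; nothing continuum ∕ OS ∕
mass-gap ∕ Clay.  No `sorry`, no `axiom`, no `def`, no `instance`.  `--supports stmt-QuantumFields-27364`.

RELATED IN THE TREE, NOT DUPLICATED: `B9Eq3104CommutatorGradFormCurl.curlY_apply_eq` (def-Y: `curlY` through `cdB` — USED), `B9SectBGWordDiffY` (gen 13: `cdB` IS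
`gradLetterF` — USED), `Node00.OpsYCurlGrad` (`holY_mul_path`, `holY_inv`), `B9Eq39Adjoint` ∕ `B9Eq37Insertion` (pv27's letters — USED).
-/

noncomputable section

namespace Literature.MathematicalPhysics.QuantumFieldTheory.Balaban1983to89.B9SectBGWordCurlHolY

open Literature.MathematicalPhysics.QuantumFieldTheory.Balaban1983to89
open Literature.MathematicalPhysics.QuantumFieldTheory.Balaban1983to89.B6KLevelCensusIndexV1 (KIdx)
open Literature.MathematicalPhysics.QuantumFieldTheory.Balaban1983to89.B9Eq39Adjoint (R covD curl plaqU)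
open Literature.MathematicalPhysics.QuantumFieldTheory.Balaban1983to89.B9Eq37Insertion (reC imC)
open Literature.MathematicalPhysics.QuantumFieldTheory.Balaban1983to89.B9Eq352DivFormLetters (gradLetterF_apply)
open Literature.MathematicalPhysics.QuantumFieldTheory.Balaban1983to89.B9Eq352GradLetters (diffLetter_inl)
open Literature.MathematicalPhysics.QuantumFieldTheory.Balaban1983to89.B9Eq371GradLetters (bT bU bT_apply bU_apply)
open Literature.MathematicalPhysics.QuantumFieldTheory.Balaban1983to89.B9Eq3104CommutatorGradFormCurl (curlY_apply_eq)
open Literature.MathematicalPhysics.QuantumFieldTheory.Balaban1983to89.B9SectBGWordDiffY (bondFunCoordsY_cdB)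
open Literature.MathematicalPhysics.QuantumFieldTheory.Balaban1983to89.Node00 (SiteY FBondY PlaqY CfgY UboxY shiftY cdB curlY holY reHolY imHolY bondCoordsY
  bondFunCoordsY bondFunCoordsY_apply bondCoordsY_symm_mk bondFunCoordsY_apply_bondCoordsY bondCoordsY_apply)
open Literature.MathematicalPhysics.QuantumFieldTheory.Balaban1983to89.Node00.OpsYNablaBridge (chartY chartY_eq shiftY_chartY)

variable {𝔸 : Type} [NormedRing 𝔸] [NormedAlgebra ℂ 𝔸] [CompleteSpace 𝔸]
variable {d ℓ : ℕ} {hd : 1 ≤ d + 1} {hL : Odd (ℓ + 1) ∧ 1 < ℓ + 1} {b₀ b₁ : ℝ}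
variable (i : KIdx d ℓ hd hL b₀ b₁)

/-- the charted background at a charted site is the background: `UboxY U μ (chart s) = U_μ(s)`. [cite: Balaban1985BackgroundPropagators, (3.1) p.390, bookkeeping] -/
theorem UboxY_chartY (U : CfgY 𝔸 i) (μ : Fin (d + 1)) (s : Site (B6GlobalChartV1.PV d ℓ i.m i.K hd hL) 0) :
    UboxY i U μ (chartY i s) = U μ s := by
  have hsymm : (B6GlobalChartV1.boxEquiv i.hN).symm (chartY i s) = s := by
    rw [← chartY_eq]; exact Equiv.symm_apply_apply _ _
  show U μ ((B6GlobalChartV1.boxEquiv i.hN).symm (chartY i s)) = U μ s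
  rw [hsymm]

/-- NODE 00's bond-sector covariant difference at a bond, in coordinates: `(∇_{U,μ}A)⟨s, κ⟩ = c_f•(D_μ F_κ)(chart s)` with pv27's `covD` along `shiftY` and
`UboxY U`, `F κ z := bondFunCoordsY A (κ, z)`. [cite: Balaban1985BackgroundPropagators, (3.3) p.390, (3.39) p.397] -/
theorem cdB_apply_eq_covD (U : CfgY 𝔸 i) (μ : Fin (d + 1)) (A : FBondY i → 𝔸) (s : Site (B6GlobalChartV1.PV d ℓ i.m i.K hd hL) 0)
    (κ : Fin (d + 1)) :
    cdB i U μ A ⟨s, κ⟩ = ((i.cf : ℝ) : ℂ) • covD (shiftY i) (UboxY i U) μ (fun z => bondFunCoordsY i A (κ, z)) (chartY i s) := by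
  have h := congrFun (bondFunCoordsY_cdB i U μ A) (κ, chartY i s)
  rw [bondFunCoordsY_apply, bondCoordsY_symm_mk, diffLetter_inl, gradLetterF_apply] at h
  have hsymm : (B6GlobalChartV1.boxEquiv i.hN).symm (chartY i s) = s := by
    rw [← chartY_eq]; exact Equiv.symm_apply_apply _ _
  have hs : (⟨(B6GlobalChartV1.boxEquiv i.hN).symm (chartY i s), κ⟩ : FBondY i) = ⟨s, κ⟩ := by
    rw [hsymm]
  rw [hs] at h
  rw [h]
  rfl

/-- ★ **(3.4) — NODE 00's covariant curl IS pv27's `curl` in bond coordinates**: `(D_U A)(p) = c_f • curl (shiftY) (UboxY U) F p.μ p.ν (chart p.src)`.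
[cite: Balaban1985BackgroundPropagators, (3.4) p.391] -/
theorem curlY_eq_curl (U : CfgY 𝔸 i) (A : FBondY i → 𝔸) (p : PlaqY i) :
    curlY i U A p = ((i.cf : ℝ) : ℂ) • curl (shiftY i) (UboxY i U) (fun κ z => bondFunCoordsY i A (κ, z)) p.μ p.ν (chartY i p.src) := by
  rw [curlY_apply_eq, cdB_apply_eq_covD, cdB_apply_eq_covD, curl, smul_sub]

/-- ★ **(3.7) — NODE 00's plaquette variable IS pv27's `plaqU` in coordinates** (same base point `x`, same orientation: `U_μ(x)U_ν(x+e_μ)U_μ(x+e_ν)⁻¹U_ν(x)⁻¹`).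
[cite: Balaban1985BackgroundPropagators, (3.7) p.391] -/
theorem holY_eq_plaqU (U : CfgY 𝔸 i) (p : PlaqY i) : holY i U p = plaqU (shiftY i) (UboxY i U) p.μ p.ν (chartY i p.src) := by
  rw [holY, plaqU, shiftY_chartY, shiftY_chartY, UboxY_chartY, UboxY_chartY, UboxY_chartY, UboxY_chartY]

/-- `Re U(∂p)` of NODE 00 IS pv27's `reC` of the same plaquette variable. [cite: Balaban1985BackgroundPropagators, (3.7) p.391] -/
theorem reHolY_eq_reC (U : CfgY 𝔸 i) (p : PlaqY i) : reHolY i U p = reC (plaqU (shiftY i) (UboxY i U) p.μ p.ν (chartY i p.src)) := by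
  rw [reHolY, reC, holY_eq_plaqU, one_div]

/-- `Im U(∂p)` of NODE 00 IS pv27's `imC` of the same plaquette variable (`−i/2 = (2i)⁻¹`). [cite: Balaban1985BackgroundPropagators, (3.7) p.391] -/
theorem imHolY_eq_imC (U : CfgY 𝔸 i) (p : PlaqY i) : imHolY i U p = imC (plaqU (shiftY i) (UboxY i U) p.μ p.ν (chartY i p.src)) := by
  have hI : (-Complex.I / 2 : ℂ) = (2 * Complex.I)⁻¹ := by
    rw [mul_inv, Complex.inv_I]
    ring
  rw [imHolY, imC, holY_eq_plaqU, hI]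

end Literature.MathematicalPhysics.QuantumFieldTheory.Balaban1983to89.B9SectBGWordCurlHolY

end
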